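import Summits.Schanuel.Schanuel.Theorems.SoloInformedX193Pieces

/-!
# X193 kernel, layer B (F9b-1): factor bookkeeping for the concrete instance

Soloist file (`solo-Schanuel-informed`, s227, 2026-09-01); DESIGN
`work/s213/X193-KERNEL-DESIGN.md`, Amendment A12 (iii).  No new definitions.

For a nonzero `x : ℤ[X]` write `nF := normalizedFactors x`.  Since `x = nF.prod * u` with a
unit `u = C (±1)`, the three quantities the budget and service laws are about decompose over
the finset `nF.toFinset` with multiplicities `nF.count`:

* `x.natDegree = ∑ m, nF.count m * m.natDegree` (`soloX_natDegree_eq_sum_factors`);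
* `‖x(z)‖ = ∏ m, ‖m(z)‖ ^ nF.count m` and its logarithm (`soloX_norm_aeval_eq_prod_factors`,
  `soloX_log_norm_aeval_eq_sum_factors`);
* `M(x_ℂ) = ∏ m, M(m_ℂ) ^ nF.count m` and its logarithm
  (`soloX_mahlerMeasure_eq_prod_factors`, `soloX_log_mahlerMeasure_eq_sum_factors`).

For the instance `soloX_pieces ξ R` of F8 the image of `alive n` in `ℤ[X]` is the set of
normalised irreducible factors of `R n` that are pieces (`soloX_mem_aliveMap_iff`); every
other normalised irreducible factor has `natDegree = 0` or is `X` (`soloX_nonpiece_factor`),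
and a count-weighted sum over all factors splits as the `mult`-weighted sum over `alive n`
plus the sum over the non-pieces (`soloX_sum_factors_split`).  First consequences: the
degree half of the budget law, `∑ P ∈ alive n, mult P n * deg P ≤ (R n).natDegree`
(`soloX_pieces_sum_mult_deg_le`), and `nF.count X ≤ (R n).natDegree`
(`soloX_count_X_le_natDegree`).
-/

namespace Summit.Schanuel.Schanuel.Theorems

open Polynomial UniqueFactorizationMonoid

/-! ## Units and the normalised factorisation of an integer polynomial -/

/-- A unit of `ℤ[X]` is `C r` with `r = 1` or `r = -1`. -/
theorem soloX_unit_eq_C (u : ℤ[X]ˣ) : ∃ r : ℤ, (r = 1 ∨ r = -1) ∧ (u : ℤ[X]) = C r := by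
  obtain ⟨r, hr, hru⟩ := Polynomial.isUnit_iff.mp u.isUnit
  exact ⟨r, Int.isUnit_iff.mp hr, hru.symm⟩

/-- Units of `ℤ[X]` take complex values of norm one. -/
theorem soloX_norm_aeval_unit (u : ℤ[X]ˣ) (z : ℂ) : ‖aeval z (u : ℤ[X])‖ = 1 := by
  obtain ⟨r, hr, hru⟩ := soloX_unit_eq_C u
  rw [hru, aeval_C, eq_intCast, Complex.norm_intCast]
  rcases hr with rfl | rfl <;> simp

/-- Units of `ℤ[X]` have Mahler measure one. -/
theorem soloX_mahlerMeasure_unit (u : ℤ[X]ˣ) :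
    ((u : ℤ[X]).map (Int.castRingHom ℂ)).mahlerMeasure = 1 := by
  obtain ⟨r, hr, hru⟩ := soloX_unit_eq_C u
  rw [hru, Polynomial.map_C, mahlerMeasure_const, eq_intCast, Complex.norm_intCast]
  rcases hr with rfl | rfl <;> simp

/-- Units of `ℤ[X]` have `natDegree = 0` (Mathlib, recorded for the chain below). -/
theorem soloX_natDegree_unit (u : ℤ[X]ˣ) : (u : ℤ[X]).natDegree = 0 :=
  natDegree_coe_units u

/-- `x = (normalizedFactors x).prod * u` for some unit `u`, if `x ≠ 0`. -/
theorem soloX_exists_prod_mul_unit {x : ℤ[X]} (hx : x ≠ 0) :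
    ∃ u : ℤ[X]ˣ, (normalizedFactors x).prod * u = x :=
  prod_normalizedFactors hx

/-- A normalised irreducible factor is nonzero. -/
theorem soloX_factor_ne_zero {x m : ℤ[X]} (hm : m ∈ normalizedFactors x) : m ≠ 0 :=
  fun h => zero_notMem_normalizedFactors x (h ▸ hm)

/-- A normalised irreducible factor that is not a piece has `natDegree = 0` or is `X`. -/
theorem soloX_nonpiece_factor {x m : ℤ[X]} (hm : m ∈ normalizedFactors x)
    (hnp : m ∉ soloX_pieceSet) : m.natDegree = 0 ∨ m = X := by
  rcases Nat.eq_zero_or_pos m.natDegree with h0 | hpos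
  · exact Or.inl h0
  by_cases hX : m = X
  · exact Or.inr hX
  exact absurd ⟨irreducible_of_normalized_factor m hm, normalize_normalized_factor m hm,
    hpos, hX⟩ hnp

/-- A nonzero integer polynomial of `natDegree = 0` takes complex values of norm `≥ 1`. -/
theorem soloX_one_le_norm_aeval_of_natDegree_eq_zero {q : ℤ[X]} (hq : q ≠ 0)
    (h0 : q.natDegree = 0) (z : ℂ) : 1 ≤ ‖aeval z q‖ := by
  have hc : q.coeff 0 ≠ 0 := by
    intro hc
    apply hq
    rw [eq_C_of_natDegree_eq_zero h0, hc, C_0]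
  rw [eq_C_of_natDegree_eq_zero h0, aeval_C, eq_intCast, Complex.norm_intCast, ← Int.cast_abs]
  exact_mod_cast Int.one_le_abs hc

/-! ## Degree, values and Mahler measure over the normalised factors -/

/-- `natDegree x = ∑ m, count m * natDegree m` over the normalised irreducible factors. -/
theorem soloX_natDegree_eq_sum_factors {x : ℤ[X]} (hx : x ≠ 0) :
    x.natDegree = ∑ m ∈ (normalizedFactors x).toFinset,
      (normalizedFactors x).count m * m.natDegree := by
  obtain ⟨u, hu⟩ := soloX_exists_prod_mul_unit hx
  obtain ⟨r, hr, hru⟩ := soloX_unit_eq_C u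
  have hr0 : r ≠ 0 := by rcases hr with rfl | rfl <;> norm_num
  conv_lhs => rw [← hu, hru]
  rw [natDegree_mul_C hr0, natDegree_multiset_prod _ (zero_notMem_normalizedFactors x),
    Finset.sum_multiset_map_count]
  simp only [smul_eq_mul]

/-- The multiplicity of `X` among the normalised factors is at most `natDegree x`. -/
theorem soloX_count_X_le_natDegree {x : ℤ[X]} (hx : x ≠ 0) :
    (normalizedFactors x).count X ≤ x.natDegree := by
  by_cases hX : X ∈ (normalizedFactors x).toFinset
  · rw [soloX_natDegree_eq_sum_factors hx]
    have h := Finset.single_le_sum (f := fun m => (normalizedFactors x).count m * m.natDegree)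
      (fun m _ => Nat.zero_le _) hX
    simpa using h
  · rw [Multiset.mem_toFinset, ← Multiset.count_eq_zero] at hX
    simp [hX]

/-- `‖x(z)‖ = ∏ m, ‖m(z)‖ ^ count m` over the normalised irreducible factors. -/
theorem soloX_norm_aeval_eq_prod_factors {x : ℤ[X]} (hx : x ≠ 0) (z : ℂ) :
    ‖aeval z x‖ = ∏ m ∈ (normalizedFactors x).toFinset,
      ‖aeval z m‖ ^ (normalizedFactors x).count m := by
  obtain ⟨u, hu⟩ := soloX_exists_prod_mul_unit hx
  conv_lhs => rw [← hu]
  rw [map_mul, norm_mul, soloX_norm_aeval_unit, mul_one, map_multiset_prod,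
    Finset.prod_multiset_map_count, norm_prod]
  exact Finset.prod_congr rfl fun m _ => norm_pow _ _

/-- `M(x_ℂ) = ∏ m, M(m_ℂ) ^ count m` over the normalised irreducible factors. -/
theorem soloX_mahlerMeasure_eq_prod_factors {x : ℤ[X]} (hx : x ≠ 0) :
    (x.map (Int.castRingHom ℂ)).mahlerMeasure = ∏ m ∈ (normalizedFactors x).toFinset,
      (m.map (Int.castRingHom ℂ)).mahlerMeasure ^ (normalizedFactors x).count m := by
  obtain ⟨u, hu⟩ := soloX_exists_prod_mul_unit hx
  conv_lhs => rw [← hu]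
  rw [Polynomial.map_mul, mahlerMeasure_mul, soloX_mahlerMeasure_unit, mul_one,
    Polynomial.map_multiset_prod, prod_mahlerMeasure_eq_mahlerMeasure_prod, Multiset.map_map]
  simp only [Function.comp_def]
  rw [Finset.prod_multiset_map_count]

/-- If `x(z) ≠ 0` then every normalised factor `m` of `x` has `m(z) ≠ 0`. -/
theorem soloX_aeval_factor_ne_zero {x m : ℤ[X]} {z : ℂ} (hz : aeval z x ≠ 0)
    (hm : m ∈ normalizedFactors x) : aeval z m ≠ 0 := by
  obtain ⟨w, hw⟩ := dvd_of_mem_normalizedFactors hm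
  intro h0
  apply hz
  rw [hw, map_mul, h0, zero_mul]

/-- `log ‖x(z)‖ = ∑ m, count m * log ‖m(z)‖` if `x(z) ≠ 0`. -/
theorem soloX_log_norm_aeval_eq_sum_factors {x : ℤ[X]} (hx : x ≠ 0) {z : ℂ}
    (hz : aeval z x ≠ 0) :
    Real.log ‖aeval z x‖ = ∑ m ∈ (normalizedFactors x).toFinset,
      ((normalizedFactors x).count m : ℝ) * Real.log ‖aeval z m‖ := by
  rw [soloX_norm_aeval_eq_prod_factors hx z, Real.log_prod]
  · exact Finset.sum_congr rfl fun m _ => Real.log_pow _ _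
  · intro m hm
    exact pow_ne_zero _ (norm_ne_zero_iff.mpr
      (soloX_aeval_factor_ne_zero hz (Multiset.mem_toFinset.mp hm)))

/-- Every normalised factor has Mahler measure `≥ 1`. -/
theorem soloX_one_le_mahlerMeasure_factor {x m : ℤ[X]} (hm : m ∈ normalizedFactors x) :
    1 ≤ (m.map (Int.castRingHom ℂ)).mahlerMeasure :=
  Polynomial.one_le_mahlerMeasure_of_ne_zero (soloX_factor_ne_zero hm)

/-- `log M(x_ℂ) = ∑ m, count m * log M(m_ℂ)`. -/
theorem soloX_log_mahlerMeasure_eq_sum_factors {x : ℤ[X]} (hx : x ≠ 0) :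
    Real.log (x.map (Int.castRingHom ℂ)).mahlerMeasure =
      ∑ m ∈ (normalizedFactors x).toFinset, ((normalizedFactors x).count m : ℝ) *
        Real.log (m.map (Int.castRingHom ℂ)).mahlerMeasure := by
  rw [soloX_mahlerMeasure_eq_prod_factors hx, Real.log_prod]
  · exact Finset.sum_congr rfl fun m _ => Real.log_pow _ _
  · intro m hm
    exact pow_ne_zero _ (zero_lt_one.trans_le
      (soloX_one_le_mahlerMeasure_factor (Multiset.mem_toFinset.mp hm))).ne'

/-! ## Regrouping over the pieces alive at level `n` -/

section regroup

variable (ξ : ℂ) (R : ℕ → ℤ[X]) (n : ℕ)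

/-- Membership in the image of `alive n` in `ℤ[X]`: the normalised factors of `R n` that are
pieces. -/
theorem soloX_mem_aliveMap_iff (m : ℤ[X]) :
    m ∈ ((soloX_pieces ξ R).alive n).map (Function.Embedding.subtype (· ∈ soloX_pieceSet)) ↔
      m ∈ normalizedFactors (R n) ∧ m ∈ soloX_pieceSet := by
  simp only [Finset.mem_map, Function.Embedding.coe_subtype]
  constructor
  · rintro ⟨P, hP, rfl⟩
    exact ⟨(soloX_pieces_mem_alive_iff ξ R P n).mp hP, P.2⟩
  · rintro ⟨hm, hp⟩
    exact ⟨⟨m, hp⟩, (soloX_pieces_mem_alive_iff ξ R ⟨m, hp⟩ n).mpr hm, rfl⟩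

/-- The image of `alive n` is contained in the finset of normalised factors of `R n`. -/
theorem soloX_aliveMap_subset :
    ((soloX_pieces ξ R).alive n).map (Function.Embedding.subtype (· ∈ soloX_pieceSet)) ⊆
      (normalizedFactors (R n)).toFinset := by
  intro m hm
  exact Multiset.mem_toFinset.mpr ((soloX_mem_aliveMap_iff ξ R n m).mp hm).1

/-- The complement of the image of `alive n` among the normalised factors: the non-pieces. -/
theorem soloX_mem_sdiff_aliveMap_iff (m : ℤ[X]) :
    m ∈ (normalizedFactors (R n)).toFinset \
        ((soloX_pieces ξ R).alive n).map (Function.Embedding.subtype (· ∈ soloX_pieceSet)) ↔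
      m ∈ normalizedFactors (R n) ∧ m ∉ soloX_pieceSet := by
  rw [Finset.mem_sdiff, Multiset.mem_toFinset, soloX_mem_aliveMap_iff]
  tauto

/-- A `mult`-weighted sum over `alive n` is the `count`-weighted sum over its image. -/
theorem soloX_sum_alive_eq_sum_map (f : ℤ[X] → ℝ) :
    ∑ P ∈ (soloX_pieces ξ R).alive n, ((soloX_pieces ξ R).mult P n : ℝ) * f P =
      ∑ m ∈ ((soloX_pieces ξ R).alive n).map
          (Function.Embedding.subtype (· ∈ soloX_pieceSet)),
        ((normalizedFactors (R n)).count m : ℝ) * f m := by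
  simp only [Finset.sum_map, Function.Embedding.coe_subtype, soloX_pieces_mult]

/-- SPLIT: a `count`-weighted sum over all normalised factors of `R n` is the `mult`-weighted
sum over `alive n` plus the `count`-weighted sum over the non-pieces. -/
theorem soloX_sum_factors_split (f : ℤ[X] → ℝ) :
    ∑ m ∈ (normalizedFactors (R n)).toFinset, ((normalizedFactors (R n)).count m : ℝ) * f m =
      ∑ P ∈ (soloX_pieces ξ R).alive n, ((soloX_pieces ξ R).mult P n : ℝ) * f P +
      ∑ m ∈ (normalizedFactors (R n)).toFinset \
          ((soloX_pieces ξ R).alive n).map (Function.Embedding.subtype (· ∈ soloX_pieceSet)),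
        ((normalizedFactors (R n)).count m : ℝ) * f m := by
  rw [soloX_sum_alive_eq_sum_map, add_comm]
  exact (Finset.sum_sdiff (soloX_aliveMap_subset ξ R n)).symm

/-- LOWER SPLIT: if `f ≥ 0` on the non-piece factors, the `mult`-weighted sum over `alive n`
is at most the `count`-weighted sum over all normalised factors. -/
theorem soloX_sum_alive_le_sum_factors (f : ℤ[X] → ℝ)
    (hf : ∀ m ∈ normalizedFactors (R n), m ∉ soloX_pieceSet → 0 ≤ f m) :
    ∑ P ∈ (soloX_pieces ξ R).alive n, ((soloX_pieces ξ R).mult P n : ℝ) * f P ≤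
      ∑ m ∈ (normalizedFactors (R n)).toFinset,
        ((normalizedFactors (R n)).count m : ℝ) * f m := by
  rw [soloX_sum_factors_split ξ R n f]
  refine le_add_of_nonneg_right (Finset.sum_nonneg fun m hm => ?_)
  obtain ⟨hm1, hm2⟩ := (soloX_mem_sdiff_aliveMap_iff ξ R n m).mp hm
  exact mul_nonneg (Nat.cast_nonneg _) (hf m hm1 hm2)

/-! ## First consequences: the degree budget -/

/-- DEGREE BUDGET (pointwise in `n`): `∑ P ∈ alive n, mult P n * deg P ≤ natDegree (R n)`. -/
theorem soloX_pieces_sum_mult_deg_le (hR : R n ≠ 0) :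
    ∑ P ∈ (soloX_pieces ξ R).alive n,
        ((soloX_pieces ξ R).mult P n : ℝ) * (soloX_pieces ξ R).deg P ≤ (R n).natDegree := by
  have htot : ((R n).natDegree : ℝ) = ∑ m ∈ (normalizedFactors (R n)).toFinset,
      ((normalizedFactors (R n)).count m : ℝ) * (m.natDegree : ℝ) := by
    rw [soloX_natDegree_eq_sum_factors hR]
    push_cast
    rfl
  have h := soloX_sum_alive_le_sum_factors ξ R n (fun m => (m.natDegree : ℝ))
    (fun m _ _ => Nat.cast_nonneg _)
  rw [← htot] at h
  simpa only [soloX_pieces_deg] using h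

/-- The degree budget for `R n = 0` is trivial: nothing is alive. -/
theorem soloX_pieces_sum_mult_deg_of_eq_zero (hR : R n = 0) :
    ∑ P ∈ (soloX_pieces ξ R).alive n,
        ((soloX_pieces ξ R).mult P n : ℝ) * (soloX_pieces ξ R).deg P = 0 := by
  refine Finset.sum_eq_zero fun P hP => ?_
  exact absurd hP (soloX_pieces_not_mem_alive_of_eq_zero ξ R P hR)

end regroup

end Summit.Schanuel.Schanuel.Theorems
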